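import Summits.BirchSwinnertonDyer.BirchSwinnertonDyer.Theorems.ByReductionTypeAtTwoMultTowerSplitOrderBound
import Summits.BirchSwinnertonDyer.BirchSwinnertonDyer.Theorems.ByReductionTypeAtTwoMultUpperHalfTowerLocal
import Summits.BirchSwinnertonDyer.BirchSwinnertonDyer.Theorems.ByReductionTypeAtTwoMultUpperHalfTowerTorsionLocal
import Summits.BirchSwinnertonDyer.BirchSwinnertonDyer.Theorems.ByReductionTypeAtTwoMultUpperHalfTowerCertAddv
import Summits.BirchSwinnertonDyer.BirchSwinnertonDyer.Theorems.ByReductionTypeAtTwoMultUpperHalfTowerCertAddv2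
import HarnessLib

/-!
# Route `ByReductionTypeAtTwo`, crux `MultUpperHalfAtTwo` (item stmt-BirchSwinnertonDyer-19922): the TOWER-gap doors at a
# SPLIT multiplicative `2` (`C₂ = 2^{k_q}`) with the PRINT binder `hSP` DISCHARGED by the kernel theorem
# `MultTowerSplitOrder.atTwo_le_pow_of_split_kernel` — drop-in twins of the five split doors the class files use

HONEST FRAMING (cell `bsd-2adic`, run/shared/lean/pub/bsd-2adic/, seat `bsd-2adic-mult` GEN 13, HUMAN RULINGS D-0036 /
D-0054 / D-0074): research route; THEOREMS ONLY; nothing is booked; BSD is not proved by any of this. These are the five split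
TOWER doors of the class files of item 19922 — `MultTowerCert.towerGapAtTwo_of_layerSelmer_cert_splitTwo` (…TowerLocal.lean),
`MultTowerAddv.…_cert_splitTwo_addv` / `…_addv2` (…TowerCertAddv.lean / …CertAddv2.lean),
`MultTowerTorsion.…_cert_splitTwo_of_torsion` / `…_cert_splitTwo_of_goodPrime` (…TowerTorsionLocal.lean) — with their PRINT hypothesis
`hSP : Greenberg1999.sec3_natCard_localTowerKerPrimary_splitMultiplicative_rat` (Greenberg, LNM 1716, §3 pp. 92–93) REMOVED and
EVERY OTHER ARGUMENT UNCHANGED (same `Dq`, `hlog`, `hkq`, same certificate arithmetic with `C₂ = 2^{k_q}`): the slot `h2` is fed by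
the tree theorem `MultTowerSplitOrder.atTwo_le_pow_of_split_kernel` (`…MultTowerSplitOrderBound.lean`, this seat: the ORDER bound
`#𝒦_{v,n}[2^∞] ≤ 2^{k_q}` proved in the kernel). So a split class file discharges `hSP` by renaming the door (`…_kernel`) and
deleting one argument. WHAT IS STILL DISPLAYED, NOT PROVED: PRINT {`h33g`, `hM`, `hA`} (and `hBtors`/`hB` on the torsion
doors); the layer counts `hlow`/`hup`, the Tate certificate (`Dq`, `hlog`, `hkq`), the torsion data and the arithmetic `harith`.
RELATION to tower-1 GEN 10's one-bit / zero-bit kernel doors (`…SplitOneBitKernel.lean`, `…SplitZeroBit.lean`): those bound the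
`2`-TORSION by `2` (any `k_q`) resp. give `𝒦 = ⊥` for `k_q = 0` in the Tate-unit-mod-8 currency, and are the sharper certificate when
`k_q ≥ 2`; the present doors keep the EXISTING certificates (`C₂ = 2^{k_q}` in the `ord₂ log₂ q_E` currency) valid verbatim.
References: R. Greenberg, LNM 1716 (1999) §3 pp. 85–93.
-/

set_option autoImplicit false
-- the Theorems namespace of this sub repeats the summit name by design (D-0017 nested layout: Summit.<S>.<Sub>)
set_option linter.dupNamespace false

noncomputable section

open scoped Classical

open NumberField IsDedekindDomain WeierstrassCurve Literature.NumberTheory.EllipticCurves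
  Literature.NumberTheory.EllipticCurves.Greenberg1999
  Summit.BirchSwinnertonDyer.Rank1Residual.X5 Summit.BirchSwinnertonDyer.Rank1Residual.X5.O1
  Summit.BirchSwinnertonDyer.Rank1Residual

namespace Summit.BirchSwinnertonDyer.BirchSwinnertonDyer.Theorems

section Doors

variable (W : WeierstrassCurve ℚ) [W.IsElliptic] [W.IsGloballyMinimal]

/-- **The GAP certificate at a SPLIT multiplicative `2`, with `hSP` discharged** (odd torsion order): PRINT {`h33g`, `hM`, `hA`} +
the Tate certificate (`Dq`, `log₂ q_E ≠ 0`, `ord₂(log₂ q_E) ≤ k_q + 2`) + layer counts at `j ≤ j'` with the arithmetic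
`2^d · 2^{k_q} · ∏_{ℓ ∈ P} C_ℓ^{2^{min(j', e_ℓ)}} < 2^{2^{j'} − 2^j + a}` ⟹ `O1.TowerGapAtTwo W`
(= `MultTowerCert.towerGapAtTwo_of_layerSelmer_cert_splitTwo` with `h2 := MultTowerSplitOrder.atTwo_le_pow_of_split_kernel`).
[cite: GreenbergLNM1716, §3 Lemmas 3.3–3.5 (PDF pp. 86–90) and pp. 90–93] [cite: SilvermanAEC2009, VII.1 Prop. 1.3, VII.5.1] -/
theorem MultTowerCert.towerGapAtTwo_of_layerSelmer_cert_splitTwo_kernel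
    (h33g : lemma33_localTowerKerPrimary_eq_bot_of_good.{0})
    (hM : lemma33_localTowerKerPrimary_cyclic_of_multiplicative.{0})
    (hA : lemma33_natCard_localTowerKerPrimary_le_four_of_additive.{0})
    (Dq : TateParameterData W 2) (hlog : padicLog 2 Dq.q ≠ 0) {kq : ℕ}
    (hkq : (padicLog 2 Dq.q).valuation ≤ (kq : ℤ) + 2)
    (htors : ¬ 2 ∣ W.torsionOrder) {j j' a d : ℕ} (hjj' : j ≤ j')
    (P : Finset ℕ) (hP : ∀ ℓ ∈ P, ℓ.Prime ∧ ℓ ≠ 2)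
    (hΔ : ∀ ℓ : ℕ, ℓ.Prime → ℓ ≠ 2 → (ℓ : ℤ) ∣ W.minimalDiscriminantInt → ℓ ∈ P)
    (C e k : ℕ → ℕ) (he : ∀ ℓ ∈ P, ¬ 2 ^ (e ℓ + 4) ∣ ℓ ^ 2 - 1)
    (hC : ∀ (ℓ : ℕ) [Fact ℓ.Prime], ℓ ∈ P →
      4 ≤ C ℓ ∨ (W.HasMultiplicativeReductionAtPrime ℓ ∧ 2 ≤ C ℓ) ∨
        (W.HasMultiplicativeReductionAtPrime ℓ ∧ (ℓ : ℤ) ^ k ℓ ∣ W.minimalDiscriminantInt ∧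
          ¬ (ℓ : ℤ) ^ (k ℓ + 1) ∣ W.minimalDiscriminantInt ∧ ¬ 2 ∣ k ℓ ∧ 1 ≤ C ℓ) ∨
        (¬ (ℓ : ℤ) ∣ W.minimalDiscriminantInt ∧ 1 ≤ C ℓ))
    (hlow : ∀ κ : ZpExtension ℚ 2, κ.IsCyclotomic →
      2 ^ a ≤ Nat.card {z : W.selmerLayer κ j // 2 • z = 0})
    (hup : ∀ κ : ZpExtension ℚ 2, κ.IsCyclotomic →
      Nat.card {z : W.selmerLayer κ j' // 2 • z = 0} ≤ 2 ^ d)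
    (harith : 2 ^ d * 2 ^ kq * ∏ ℓ ∈ P, C ℓ ^ 2 ^ min j' (e ℓ) < 2 ^ (2 ^ j' - 2 ^ j + a)) :
    TowerGapAtTwo W :=
  MultTowerCert.towerGapAtTwo_of_layerSelmer_cert_atTwo W h33g hM hA htors hjj' (2 ^ kq)
    (MultTowerSplitOrder.atTwo_le_pow_of_split_kernel W Dq hlog
      (by rw [MultTowerCert.padicValNat_two_four]; exact_mod_cast hkq) j')
    P hP hΔ C e k he hC hlow hup harith

/-- **The GAP certificate (FIVE disjuncts) at a SPLIT multiplicative `2`, with `hSP` discharged**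
(= `MultTowerAddv.towerGapAtTwo_of_layerSelmer_cert_splitTwo_addv` with `h2 := MultTowerSplitOrder.atTwo_le_pow_of_split_kernel`;
arithmetic `2^d · 2^{k_q} · ∏_{ℓ ∈ P} C_ℓ^{2^{min(j', e_ℓ)}} < 2^{2^{j'} − 2^j + a}`).
[cite: GreenbergLNM1716, §3 Lemmas 3.3–3.5 (PDF pp. 86–90) and pp. 90–93] [cite: SilvermanATAEC1994, IV.9 Table 4.1] -/
theorem MultTowerAddv.towerGapAtTwo_of_layerSelmer_cert_splitTwo_addv_kernel
    (h33g : lemma33_localTowerKerPrimary_eq_bot_of_good.{0})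
    (hM : lemma33_localTowerKerPrimary_cyclic_of_multiplicative.{0})
    (hA : lemma33_natCard_localTowerKerPrimary_le_four_of_additive.{0})
    (Dq : TateParameterData W 2) (hlog : padicLog 2 Dq.q ≠ 0) {kq : ℕ}
    (hkq : (padicLog 2 Dq.q).valuation ≤ (kq : ℤ) + 2)
    (htors : ¬ 2 ∣ W.torsionOrder) {j j' a d : ℕ} (hjj' : j ≤ j')
    (P : Finset ℕ) (hP : ∀ ℓ ∈ P, ℓ.Prime ∧ ℓ ≠ 2)
    (hΔ : ∀ ℓ : ℕ, ℓ.Prime → ℓ ≠ 2 → (ℓ : ℤ) ∣ W.minimalDiscriminantInt → ℓ ∈ P)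
    (C e k : ℕ → ℕ) (he : ∀ ℓ ∈ P, ¬ 2 ^ (e ℓ + 4) ∣ ℓ ^ 2 - 1)
    (hC : ∀ (ℓ : ℕ) [Fact ℓ.Prime], ℓ ∈ P →
      4 ≤ C ℓ ∨ (W.HasMultiplicativeReductionAtPrime ℓ ∧ 2 ≤ C ℓ) ∨
        (W.HasMultiplicativeReductionAtPrime ℓ ∧ (ℓ : ℤ) ^ k ℓ ∣ W.minimalDiscriminantInt ∧
          ¬ (ℓ : ℤ) ^ (k ℓ + 1) ∣ W.minimalDiscriminantInt ∧ ¬ 2 ∣ k ℓ ∧ 1 ≤ C ℓ) ∨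
        (¬ (ℓ : ℤ) ∣ W.minimalDiscriminantInt ∧ 1 ≤ C ℓ) ∨
        ((ℓ : ℤ) ∣ (integralModelInt W).c₄ ∧ (ℓ : ℤ) ^ k ℓ ∣ W.minimalDiscriminantInt ∧
          ¬ (ℓ : ℤ) ^ (k ℓ + 1) ∣ W.minimalDiscriminantInt ∧
          (k ℓ = 2 ∨ k ℓ = 4 ∨ k ℓ = 5 ∨ (7 ≤ k ℓ ∧ k ℓ ≠ 9 ∧ (ℓ : ℤ) ^ k ℓ ∣ (integralModelInt W).c₄ ^ 3)) ∧ 1 ≤ C ℓ))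
    (hlow : ∀ κ : ZpExtension ℚ 2, κ.IsCyclotomic →
      2 ^ a ≤ Nat.card {z : W.selmerLayer κ j // 2 • z = 0})
    (hup : ∀ κ : ZpExtension ℚ 2, κ.IsCyclotomic →
      Nat.card {z : W.selmerLayer κ j' // 2 • z = 0} ≤ 2 ^ d)
    (harith : 2 ^ d * 2 ^ kq * ∏ ℓ ∈ P, C ℓ ^ 2 ^ min j' (e ℓ) < 2 ^ (2 ^ j' - 2 ^ j + a)) :
    TowerGapAtTwo W :=
  MultTowerAddv.towerGapAtTwo_of_layerSelmer_cert_atTwo_addv W h33g hM hA htors hjj' (2 ^ kq)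
    (MultTowerSplitOrder.atTwo_le_pow_of_split_kernel W Dq hlog
      (by rw [MultTowerCert.padicValNat_two_four]; exact_mod_cast hkq) j')
    P hP hΔ C e k he hC hlow hup harith

/-- **The GAP certificate (SIX disjuncts) at a SPLIT multiplicative `2`, with `hSP` discharged**
(= `MultTowerAddv.towerGapAtTwo_of_layerSelmer_cert_splitTwo_addv2` with `h2 := MultTowerSplitOrder.atTwo_le_pow_of_split_kernel`;
arithmetic `2^d · 2^{k_q} · ∏_{ℓ ∈ P} C_ℓ^{2^{min(j', e_ℓ)}} < 2^{2^{j'} − 2^j + a}`).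
[cite: GreenbergLNM1716, §3 Lemmas 3.3–3.5 (PDF pp. 86–90) and pp. 90–93] [cite: SilvermanATAEC1994, IV.9 Table 4.1] -/
theorem MultTowerAddv.towerGapAtTwo_of_layerSelmer_cert_splitTwo_addv2_kernel
    (h33g : lemma33_localTowerKerPrimary_eq_bot_of_good.{0})
    (hM : lemma33_localTowerKerPrimary_cyclic_of_multiplicative.{0})
    (hA : lemma33_natCard_localTowerKerPrimary_le_four_of_additive.{0})
    (Dq : TateParameterData W 2) (hlog : padicLog 2 Dq.q ≠ 0) {kq : ℕ}
    (hkq : (padicLog 2 Dq.q).valuation ≤ (kq : ℤ) + 2)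
    (htors : ¬ 2 ∣ W.torsionOrder) {j j' a d : ℕ} (hjj' : j ≤ j')
    (P : Finset ℕ) (hP : ∀ ℓ ∈ P, ℓ.Prime ∧ ℓ ≠ 2)
    (hΔ : ∀ ℓ : ℕ, ℓ.Prime → ℓ ≠ 2 → (ℓ : ℤ) ∣ W.minimalDiscriminantInt → ℓ ∈ P)
    (C e k : ℕ → ℕ) (he : ∀ ℓ ∈ P, ¬ 2 ^ (e ℓ + 4) ∣ ℓ ^ 2 - 1)
    (hC : ∀ (ℓ : ℕ) [Fact ℓ.Prime], ℓ ∈ P →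
      4 ≤ C ℓ ∨ (W.HasMultiplicativeReductionAtPrime ℓ ∧ 2 ≤ C ℓ) ∨
        (W.HasMultiplicativeReductionAtPrime ℓ ∧ (ℓ : ℤ) ^ k ℓ ∣ W.minimalDiscriminantInt ∧
          ¬ (ℓ : ℤ) ^ (k ℓ + 1) ∣ W.minimalDiscriminantInt ∧ ¬ 2 ∣ k ℓ ∧ 1 ≤ C ℓ) ∨
        (¬ (ℓ : ℤ) ∣ W.minimalDiscriminantInt ∧ 1 ≤ C ℓ) ∨
        ((ℓ : ℤ) ∣ (integralModelInt W).c₄ ∧ (ℓ : ℤ) ^ k ℓ ∣ W.minimalDiscriminantInt ∧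
          ¬ (ℓ : ℤ) ^ (k ℓ + 1) ∣ W.minimalDiscriminantInt ∧
          (k ℓ = 2 ∨ k ℓ = 4 ∨ k ℓ = 5 ∨ (7 ≤ k ℓ ∧ k ℓ ≠ 9 ∧ (ℓ : ℤ) ^ k ℓ ∣ (integralModelInt W).c₄ ^ 3)) ∧ 1 ≤ C ℓ) ∨
        ((ℓ : ℤ) ∣ (integralModelInt W).c₄ ∧ (ℓ : ℤ) ^ k ℓ ∣ W.minimalDiscriminantInt ∧
          ¬ (ℓ : ℤ) ^ (k ℓ + 1) ∣ W.minimalDiscriminantInt ∧ 1 ≤ k ℓ ∧ k ℓ ≠ 6 ∧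
          (ℓ : ℤ) ^ k ℓ ∣ (integralModelInt W).c₄ ^ 3 ∧ 2 ≤ C ℓ))
    (hlow : ∀ κ : ZpExtension ℚ 2, κ.IsCyclotomic →
      2 ^ a ≤ Nat.card {z : W.selmerLayer κ j // 2 • z = 0})
    (hup : ∀ κ : ZpExtension ℚ 2, κ.IsCyclotomic →
      Nat.card {z : W.selmerLayer κ j' // 2 • z = 0} ≤ 2 ^ d)
    (harith : 2 ^ d * 2 ^ kq * ∏ ℓ ∈ P, C ℓ ^ 2 ^ min j' (e ℓ) < 2 ^ (2 ^ j' - 2 ^ j + a)) :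
    TowerGapAtTwo W :=
  MultTowerAddv.towerGapAtTwo_of_layerSelmer_cert_atTwo_addv2 W h33g hM hA htors hjj' (2 ^ kq)
    (MultTowerSplitOrder.atTwo_le_pow_of_split_kernel W Dq hlog
      (by rw [MultTowerCert.padicValNat_two_four]; exact_mod_cast hkq) j')
    P hP hΔ C e k he hC hlow hup harith

/-- **The GAP certificate at a SPLIT multiplicative `2`, rational `2`-torsion allowed, with `hSP` discharged** (any lower layer
`j`; = `MultTowerTorsion.towerGapAtTwo_of_layerSelmer_cert_splitTwo_of_torsion` with
`h2 := MultTowerSplitOrder.atTwo_le_pow_of_split_kernel`). [cite: GreenbergLNM1716, §3 pp. 85–94 (Lemmas 3.3–3.5; between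
Prop. 3.6 and 3.7, PDF pp. 92–93)] [cite: SilvermanAEC2009, VII.1 Prop. 1.3, VII.5.1] -/
theorem MultTowerTorsion.towerGapAtTwo_of_layerSelmer_cert_splitTwo_of_torsion_kernel
    (h33g : lemma33_localTowerKerPrimary_eq_bot_of_good.{0})
    (hM : lemma33_localTowerKerPrimary_cyclic_of_multiplicative.{0})
    (hA : lemma33_natCard_localTowerKerPrimary_le_four_of_additive.{0})
    (Dq : TateParameterData W 2) (hlog : padicLog 2 Dq.q ≠ 0) {kq : ℕ}
    (hkq : (padicLog 2 Dq.q).valuation ≤ (kq : ℤ) + 2)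
    (hB : ∀ κ : ZpExtension ℚ 2, κ.IsCyclotomic →
      Finite (FixedPoints.addSubgroup κ.kerSubgroup (geomPrimaryTorsion W 2)))
    {j j' a d t : ℕ} (hjj' : j ≤ j')
    (htor : ∀ κ : ZpExtension ℚ 2, κ.IsCyclotomic →
      Nat.card {m : geomPrimaryTorsion W 2 | ∀ σ ∈ κ.layerSubgroup j, σ • m = m} ≤ 2 ^ t)
    (P : Finset ℕ) (hP : ∀ ℓ ∈ P, ℓ.Prime ∧ ℓ ≠ 2)
    (hΔ : ∀ ℓ : ℕ, ℓ.Prime → ℓ ≠ 2 → (ℓ : ℤ) ∣ W.minimalDiscriminantInt → ℓ ∈ P)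
    (C e k : ℕ → ℕ) (he : ∀ ℓ ∈ P, ¬ 2 ^ (e ℓ + 4) ∣ ℓ ^ 2 - 1)
    (hC : ∀ (ℓ : ℕ) [Fact ℓ.Prime], ℓ ∈ P →
      4 ≤ C ℓ ∨ (W.HasMultiplicativeReductionAtPrime ℓ ∧ 2 ≤ C ℓ) ∨
        (W.HasMultiplicativeReductionAtPrime ℓ ∧ (ℓ : ℤ) ^ k ℓ ∣ W.minimalDiscriminantInt ∧
          ¬ (ℓ : ℤ) ^ (k ℓ + 1) ∣ W.minimalDiscriminantInt ∧ ¬ 2 ∣ k ℓ ∧ 1 ≤ C ℓ) ∨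
        (¬ (ℓ : ℤ) ∣ W.minimalDiscriminantInt ∧ 1 ≤ C ℓ))
    (hlow : ∀ κ : ZpExtension ℚ 2, κ.IsCyclotomic →
      2 ^ a ≤ Nat.card {z : W.selmerLayer κ j // 2 • z = 0})
    (hup : ∀ κ : ZpExtension ℚ 2, κ.IsCyclotomic →
      Nat.card {z : W.selmerLayer κ j' // 2 • z = 0} ≤ 2 ^ d)
    (harith : 2 ^ (d + t) * 2 ^ kq * ∏ ℓ ∈ P, C ℓ ^ 2 ^ min j' (e ℓ) < 2 ^ (2 ^ j' - 2 ^ j + a)) :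
    TowerGapAtTwo W :=
  MultTowerTorsion.towerGapAtTwo_of_layerSelmer_cert_atTwo_of_torsion W h33g hM hA hB hjj' htor (2 ^ kq)
    (MultTowerSplitOrder.atTwo_le_pow_of_split_kernel W Dq hlog
      (by rw [MultTowerCert.padicValNat_two_four]; exact_mod_cast hkq) j')
    P hP hΔ C e k he hC hlow hup harith

/-- **The GAP certificate at a SPLIT multiplicative `2`, lower layer `ℚ`, every datum PRINT or decidable, with `hSP` discharged**
(= `MultTowerTorsion.towerGapAtTwo_of_layerSelmer_cert_splitTwo_of_goodPrime` with
`h2 := MultTowerSplitOrder.atTwo_le_pow_of_split_kernel`; arithmetic `2^{d+t} · 2^{k_q} · ∏ C_ℓ^{…} < 2^{2^{j'} − 1 + a}`).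
[cite: GreenbergLNM1716, §1 p. 62, §3 pp. 85–94, §4 Lemma 4.3] [cite: SilvermanAEC2009, VII.3 Prop. 3.1(b), VII.5.1]
[cite: Ribet1981KatzLangAppendix, Theorem (p. 315)] -/
theorem MultTowerTorsion.towerGapAtTwo_of_layerSelmer_cert_splitTwo_of_goodPrime_kernel
    (h33g : lemma33_localTowerKerPrimary_eq_bot_of_good.{0})
    (hM : lemma33_localTowerKerPrimary_cyclic_of_multiplicative.{0})
    (hA : lemma33_natCard_localTowerKerPrimary_le_four_of_additive.{0})
    (hBtors : finite_torsion_cyclotomicZpExtension)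
    (Dq : TateParameterData W 2) (hlog : padicLog 2 Dq.q ≠ 0) {kq : ℕ}
    (hkq : (padicLog 2 Dq.q).valuation ≤ (kq : ℤ) + 2)
    (ℓ₀ : ℕ) [Fact ℓ₀.Prime] (h3 : 3 ≤ ℓ₀) (hgood : W.HasGoodReductionAtPrime ℓ₀) {t n : ℕ}
    (hn : W.reductionPointCount ℓ₀ = n) (hndvd : ¬ 2 ^ (t + 1) ∣ n) {j' a d : ℕ}
    (P : Finset ℕ) (hP : ∀ ℓ ∈ P, ℓ.Prime ∧ ℓ ≠ 2)
    (hΔ : ∀ ℓ : ℕ, ℓ.Prime → ℓ ≠ 2 → (ℓ : ℤ) ∣ W.minimalDiscriminantInt → ℓ ∈ P)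
    (C e k : ℕ → ℕ) (he : ∀ ℓ ∈ P, ¬ 2 ^ (e ℓ + 4) ∣ ℓ ^ 2 - 1)
    (hC : ∀ (ℓ : ℕ) [Fact ℓ.Prime], ℓ ∈ P →
      4 ≤ C ℓ ∨ (W.HasMultiplicativeReductionAtPrime ℓ ∧ 2 ≤ C ℓ) ∨
        (W.HasMultiplicativeReductionAtPrime ℓ ∧ (ℓ : ℤ) ^ k ℓ ∣ W.minimalDiscriminantInt ∧
          ¬ (ℓ : ℤ) ^ (k ℓ + 1) ∣ W.minimalDiscriminantInt ∧ ¬ 2 ∣ k ℓ ∧ 1 ≤ C ℓ) ∨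
        (¬ (ℓ : ℤ) ∣ W.minimalDiscriminantInt ∧ 1 ≤ C ℓ))
    (hlow : ∀ κ : ZpExtension ℚ 2, κ.IsCyclotomic →
      2 ^ a ≤ Nat.card {z : W.selmerLayer κ 0 // 2 • z = 0})
    (hup : ∀ κ : ZpExtension ℚ 2, κ.IsCyclotomic →
      Nat.card {z : W.selmerLayer κ j' // 2 • z = 0} ≤ 2 ^ d)
    (harith : 2 ^ (d + t) * 2 ^ kq * ∏ ℓ ∈ P, C ℓ ^ 2 ^ min j' (e ℓ) < 2 ^ (2 ^ j' - 1 + a)) :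
    TowerGapAtTwo W :=
  MultTowerTorsion.towerGapAtTwo_of_layerSelmer_cert_splitTwo_of_torsion_kernel W h33g hM hA Dq hlog hkq
    (fun κ hκ ↦ hBtors W 2 κ hκ) (Nat.zero_le j')
    (fun κ _ ↦ MultTowerTorsion.natCard_fixedBy_layerSubgroup_zero_le_of_goodPrime W ℓ₀ h3 hgood hn hndvd κ)
    P hP hΔ C e k he hC hlow hup (by rw [pow_zero]; exact harith)

end Doors

end Summit.BirchSwinnertonDyer.BirchSwinnertonDyer.Theorems

end
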